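import Literature.Combinatorics.Sahi2008.Symmetry
import Literature.Combinatorics.Sahi2008.Percolation
import Literature.Combinatorics.Sahi2008.Indicators
import Literature.Probability.LatticeModels.ProdBernoulliIndependence
import Summits.CriticalPhenomena.PercolationContinuityZ3.Theorems.SahiConjecture
import Summits.CriticalPhenomena.PercolationContinuityZ3.Theorems.PercNearOneGluingNoHeavyLowerTailSahiC3CubeAnyIndex

/-!
# The master family `E_k ≥ 0` on product measures, and its conjectured equality locus (the zero-flag class)

An OBLIGATION / STATEMENT file of the one-cut programme (crux `NoHeavyLowerTail`, stmt-CriticalPhenomena-4575; cell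
`prim-l12`, unit `prim-master-conj`).  It states, for every order `k`, the two halves of the "master conjecture"
behind the `|A| = 4` (`C⁺ = E₂`-type) and `|A| = 5` (`E3GRP = E₃`-type) rungs of the one-cut ladder, in the tree's
vocabulary (`Literature.Combinatorics.Sahi2008.sahiE` = Sahi's `E_k` [Sahi2008; LiebSahi2021, Prop. 3.3],
`bernoulliWeight p` = the product weight on `Set ι`, `DecisionTree.ind` = real indicators,
`Literature.Probability.Percolation.DeterminedBy` = "event determined by a set of coordinates"):

* `MasterFamilyNonneg k` (the cell brief's `masterFamily_nonneg k`): for every finite `ι`, every `p : ι → [0,1]`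
  and every `k` increasing events `U_0,…,U_{k−1} ⊆ 2^ι`, `0 ≤ E_k(μ_p; 1_{U_0},…,1_{U_{k−1}})`.  This is Sahi's
  `C_k` [Sahi2008, Conj. 5] RESTRICTED to product measures (`k = 3` is Kahn's Conjecture 5 [Kahn2022],
  `masterFamilyNonneg_three_iff_kahnConjecture`); by the layer-cake lemma it is the whole of `C_k` for product weights
  (`masterFamilyNonneg_iff_sahiPositive`).  PROVED here: `k ≤ 2` (`k = 2` = Harris/FKG), the hierarchy
  `k + 1 ⇒ k` (`masterFamilyNonneg_antitone`), `SahiConjecture k ⇒` it, and `k = 3` on at most three coordinates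
  (prim-sahi's kernel certificate `SahiC3Cube.sahiC3_of_card_le_three`).  OPEN for `k ≥ 3` in general.
* `MasterFamilyEqIff k` (the brief's `masterFamily_eq_iff k`): for `p` in the OPEN cube `(0,1)^ι` and increasing
  `U`, `E_k(μ_p; 1_U) = 0 ↔ SuppZeroFlag k U`, where the **zero-flag class** `SuppZeroFlag` is the `p`-free recursive
  support pattern
    `Z_2 = {(U,V) : U, V determined by disjoint coordinate sets}`,
    `Z_{k+1} = {U : ∃ i, U_{−i} ∈ Z_k ∧ ∀ l ≠ i, (U_{−i} with U_l ↦ U_l ∩ U_i) ∈ Z_k}`.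
  The direction `⇐` is a THEOREM for every `k` and every `p` (`sahiE_ind_eq_zero_of_suppZeroFlag`, no monotonicity
  needed): it is forced by the Lieb–Sahi recursion peeled at slot `i`,
    `E_{k+1}(U) = Σ_{l ≠ i} E_k(U_{−i}, U_l ↦ U_l ∩ U_i) − P(U_i)·E_k(U_{−i})`   (`sahiE_peel`),
  and Harris independence of disjointly determined events.  The direction `⇒` is OUR CONJECTURE (new; not in print):
  given `C_{k−1}` it is equivalent to HEREDITY "`E_k(U) = 0 ⇒ E_{k−1}(U_{−i}) = 0` for some `i`"; `k = 2` is the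
  equality case of Harris' inequality (disjoint essential supports), `k = 3` is the cell's criterion (Z).
  EVIDENCE (exact, exhaustive; cell prim-sahi CENSUS.md §1–2 + this unit's acceptance test 2026-08-19): the class
  reproduces EVERY identically-zero tuple and nothing else on `{0,1}^3` for `k = 3,4,5,6` (25/56/95/149 zero
  multisets), on `{0,1}^4` for `k = 3` (784), `k = 4` (7 944) and `k = 5` (77 494 multisets = 3 961 `S₄`-orbits), and
  for `k = 3` on `{0,1}^5` (23 767) — see `run/shared/lean/prim/MASTER-FAMILY.md §MASTER`.  Never import
  `MasterFamilyEqIff k`, `k ≥ 3`, or `MasterFamilyNonneg k`, `k ≥ 3`, as facts.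

Abstract layer (any weight, any real functions): `SahiZeroFlag μ k F`, `sahiE_eq_zero_of_sahiZeroFlag` (all `k`).
HONEST FRAMING: nothing here claims `C_k`; conditional use toward `θ(p_c) = 0` is the lead's business.
-/

noncomputable section

namespace Summit.CriticalPhenomena.PercolationContinuityZ3.Theorems

open Finset Function MeasureTheory
open Literature.Combinatorics.Sahi2008
open Literature.Probability.LatticeModels (prodBernoulli sahiE3 prodBernoulli_real_inter_of_determinedBy_disjoint)
open Literature.Probability.Percolation (DeterminedBy)
open Literature.Probability.Percolation.DecisionTree (ind ind_of_mem ind_of_not_mem ind_nonneg)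

/-! ### The Lieb–Sahi recursion peeled at an arbitrary slot -/

section Abstract

variable {α : Type*} [Fintype α]

/-- **The recursion peeled at slot `i`**: `E_{n+2}(F) = Σ_l E_{n+1}(F_{−i} with slot l multiplied by F_i)
− E_{n+1}(F_{−i})·E(F_i)`, where `F_{−i} = (j ↦ F (i.succAbove j))` is the family with slot `i` deleted
(Lieb–Sahi's recursion [LiebSahi2021, Prop. 3.3] is the case of the last slot, the tree's definition the case of
slot `0`; the general slot follows from the symmetry of `E_n`, `sahiE_comp_perm`). [this work] -/
theorem sahiE_peel (μ : α → ℝ) (n : ℕ) (F : Fin (n + 2) → α → ℝ) (i : Fin (n + 2)) :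
    sahiE μ (n + 2) F =
      (∑ l : Fin (n + 1), sahiE μ (n + 1)
          (update (fun j => F (i.succAbove j)) l (F (i.succAbove l) * F i))) -
        sahiE μ (n + 1) (fun j => F (i.succAbove j)) * ex μ (F i) := by
  have hF : F = fun j =>
      (Fin.cons (F i) (fun j => F (i.succAbove j)) : Fin (n + 2) → α → ℝ) (i.cycleRange j) := by
    funext j
    rw [Fin.cons_apply_cycleRange]
    exact (congrFun (Fin.insertNth_self_removeNth i F) j).symm
  conv_lhs => rw [hF]
  rw [sahiE_comp_perm, sahiE_fin_cons]

/-! ### The zero-flag class (abstract form: any weight, any functions) -/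

/-- **The zero-flag class of order `n`** for a weight `μ` and a family `F : Fin n → (α → ℝ)`, defined by recursion
on `n`: orders `0, 1, 2` are "`E_n(F) = 0`" itself (`E_0 = 0`, `E_1 = E`, `E_2 = Cov`), and for `n + 3` functions
`F` is a zero flag iff for SOME slot `i` the deleted family `F_{−i}` is a zero flag of order `n + 2` and so is
every family `F_{−i}` with one slot `l` multiplied by `F_i`.  By `sahiE_peel` this forces `E_{n+3}(F) = 0`
(`sahiE_eq_zero_of_sahiZeroFlag`); the conjecture `MasterFamilyEqIff` says that for indicator families of
increasing events under a product measure in the open cube nothing else vanishes. [this work] -/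
def SahiZeroFlag (μ : α → ℝ) : (n : ℕ) → (Fin n → α → ℝ) → Prop
  | 0, _ => True
  | 1, F => ex μ (F 0) = 0
  | 2, F => sahiE μ 2 F = 0
  | n + 3, F => ∃ i : Fin (n + 3), SahiZeroFlag μ (n + 2) (fun j => F (i.succAbove j)) ∧
      ∀ l : Fin (n + 2), SahiZeroFlag μ (n + 2)
        (update (fun j => F (i.succAbove j)) l (F (i.succAbove l) * F i))

/-- **Zero flags vanish**: `SahiZeroFlag μ n F → E_n(F) = 0`, for every order `n`, every weight and every family of
functions (induction on `n` along `sahiE_peel`). [this work] -/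
theorem sahiE_eq_zero_of_sahiZeroFlag (μ : α → ℝ) :
    ∀ (n : ℕ) (F : Fin n → α → ℝ), SahiZeroFlag μ n F → sahiE μ n F = 0
  | 0, F, _ => sahiE_zero μ F
  | 1, F, h => by rw [sahiE_one_apply]; exact h
  | 2, _, h => h
  | n + 3, F, ⟨i, h0, hl⟩ => by
    rw [sahiE_peel μ (n + 1) F i, sahiE_eq_zero_of_sahiZeroFlag μ (n + 2) _ h0, zero_mul, sub_zero]
    exact Finset.sum_eq_zero fun l _ => sahiE_eq_zero_of_sahiZeroFlag μ (n + 2) _ (hl l)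

end Abstract

/-! ### The master family on product measures: positivity -/

/-- **Master family, positivity half** (`masterFamily_nonneg k` of the cell brief): for every finite index type `ι`,
every `p : ι → [0,1]` and every `k` increasing events `U_j ⊆ 2^ι`,
`0 ≤ E_k(μ_p; 1_{U_0},…,1_{U_{k−1}})` — Sahi's `C_k` [Sahi2008, Conj. 5] restricted to product measures; `k = 3` is
Kahn's Conjecture 5 [Kahn2022] (`masterFamilyNonneg_three_iff_kahnConjecture`).  PROVED for `k ≤ 2`
(`masterFamilyNonneg_of_le_two`) and for `k = 3` on `≤ 3` coordinates; OPEN for `k ≥ 3`.  An obligation /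
hypothesis, never a fact. [this work] [status: open for k ≥ 3] -/
@[conjecture] def MasterFamilyNonneg (k : ℕ) : Prop :=
  ∀ (ι : Type) [Fintype ι] (p : ι → unitInterval) (U : Fin k → Set (Set ι)),
    (∀ j, IsUpperSet (U j)) → 0 ≤ sahiE (bernoulliWeight p) k (fun j => ind (U j))

/-- **Master family, positivity half, decreasing events** (the percolation separations `D[X|Y]` are decreasing):
`0 ≤ E_k(μ_p; 1_{D_0},…,1_{D_{k−1}})` for `k` decreasing events.  Equivalent to `MasterFamilyNonneg k` by order
duality (`masterFamilyNonnegLower_iff`). [this work] [status: open for k ≥ 3] -/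
@[conjecture] def MasterFamilyNonnegLower (k : ℕ) : Prop :=
  ∀ (ι : Type) [Fintype ι] (p : ι → unitInterval) (D : Fin k → Set (Set ι)),
    (∀ j, IsLowerSet (D j)) → 0 ≤ sahiE (bernoulliWeight p) k (fun j => ind (D j))

section Positivity

variable {ι : Type*} [Fintype ι]

omit [Fintype ι] in
/-- The indicator of the sure event is the constant `1`. [folklore] -/
theorem ind_univ_eq_one : ind (Set.univ : Set (Set ι)) = 1 := by
  funext ω; exact ind_of_mem (Set.mem_univ ω)

omit [Fintype ι] in
/-- Indicator families of increasing events are nonnegative and monotone (plumbing). [folklore] -/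
theorem ind_family_nonneg_monotone {k : ℕ} {U : Fin k → Set (Set ι)} (hU : ∀ j, IsUpperSet (U j)) :
    (∀ j ω, 0 ≤ ind (U j) ω) ∧ ∀ j, Monotone (ind (U j)) :=
  ⟨fun j ω => ind_nonneg (U j) ω, fun j => monotone_ind_of_isUpperSet (hU j)⟩

/-- Order-`k` Sahi positivity of the product weight gives the `k`-th master inequality for increasing events.
[cite: LiebSahi2021, Conj. 1.1 and Lemma 2.2] -/
theorem sahiE_ind_nonneg_of_sahiPositive (p : ι → unitInterval) {k : ℕ} (h : SahiPositive (bernoulliWeight p) k)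
    {U : Fin k → Set (Set ι)} (hU : ∀ j, IsUpperSet (U j)) :
    0 ≤ sahiE (bernoulliWeight p) k (fun j => ind (U j)) :=
  h _ (ind_family_nonneg_monotone hU).1 (ind_family_nonneg_monotone hU).2

/-- Order-`k` Sahi positivity of the DUAL product weight gives the `k`-th master inequality for decreasing events.
[cite: LiebSahi2021, Conj. 1.1 and footnote 2] -/
theorem sahiE_ind_nonneg_of_sahiPositive_lower (p : ι → unitInterval) {k : ℕ}
    (h : SahiPositive (bernoulliWeightDual p) k) {D : Fin k → Set (Set ι)} (hD : ∀ j, IsLowerSet (D j)) :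
    0 ≤ sahiE (bernoulliWeight p) k (fun j => ind (D j)) :=
  h (fun j a => ind (D j) (OrderDual.ofDual a)) (fun j a => ind_nonneg (D j) (OrderDual.ofDual a))
    (fun j => monotone_ind_toDual_of_isLowerSet (hD j))

end Positivity

/-- **`C_k ⇒` the `k`-th master inequality** (product weights are FKG posets), written `SahiConjecture k ≤ ·`.
[cite: Sahi2008, Conj. 5 (p. 212); LiebSahi2021, Conj. 1.1] -/
theorem sahiConjecture_le_masterFamilyNonneg (k : ℕ) : SahiConjecture k ≤ MasterFamilyNonneg k :=
  fun hC ι _ p _ hU =>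
    sahiE_ind_nonneg_of_sahiPositive p (hC (Set ι) (bernoulliWeight p) (isFKGMeasure_bernoulliWeight p)) hU

/-- **`C_k ⇒` the `k`-th master inequality for decreasing events** (apply `C_k` to the order dual).
[cite: Sahi2008, Conj. 5 (p. 212); LiebSahi2021, Conj. 1.1 and footnote 2] -/
theorem sahiConjecture_le_masterFamilyNonnegLower (k : ℕ) : SahiConjecture k ≤ MasterFamilyNonnegLower k :=
  fun hC ι _ p _ hD =>
    sahiE_ind_nonneg_of_sahiPositive_lower p
      (hC (Set ι)ᵒᵈ (bernoulliWeightDual p) (isFKGMeasure_bernoulliWeightDual p)) hD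

/-- **The master family is the whole of `C_k` for product weights** (layer-cake reduction [LiebSahi2021, Lemma 2.2]):
`MasterFamilyNonneg k` iff every product weight `bernoulliWeight p` (finite `ι`) is Sahi-positive of order `k`.
[cite: LiebSahi2021, Lemma 2.2; Kahn2022, Conj. 5 (arXiv p. 3)] -/
theorem masterFamilyNonneg_iff_sahiPositive (k : ℕ) :
    MasterFamilyNonneg k ↔ ∀ (ι : Type) [Fintype ι] (p : ι → unitInterval), SahiPositive (bernoulliWeight p) k := by
  constructor
  · intro h ι _ p
    classical
    rw [sahiPositive_iff_indicators]
    intro Uf hUf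
    have e : (fun i => setInd (Uf i)) = fun i => ind ((Uf i : Finset (Set ι)) : Set (Set ι)) := by
      funext i ω
      by_cases hω : ω ∈ Uf i
      · rw [setInd_apply, if_pos hω, ind_of_mem (Finset.mem_coe.2 hω)]
      · rw [setInd_apply, if_neg hω, ind_of_not_mem fun h' => hω (Finset.mem_coe.1 h')]
    rw [e]
    exact h ι p (fun i => (Uf i : Set (Set ι))) hUf
  · intro h ι _ p U hU
    exact sahiE_ind_nonneg_of_sahiPositive p (h ι p) hU

/-- **The master inequality holds for `k ≤ 2`** (`k = 2` is Harris' inequality, via Mathlib's `fkg`).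
[cite: LiebSahi2021, eq. (1.2)] -/
theorem masterFamilyNonneg_of_le_two {k : ℕ} (hk : k ≤ 2) : MasterFamilyNonneg k :=
  sahiConjecture_le_masterFamilyNonneg k (sahiConjecture_of_le_two hk)

/-- The decreasing form for `k ≤ 2`. [cite: LiebSahi2021, eq. (1.2) and footnote 2] -/
theorem masterFamilyNonnegLower_of_le_two {k : ℕ} (hk : k ≤ 2) : MasterFamilyNonnegLower k :=
  sahiConjecture_le_masterFamilyNonnegLower k (sahiConjecture_of_le_two hk)

/-- **Hierarchy of the master family**: `k ↦ MasterFamilyNonneg k` is antitone (`k + 1 ⇒ k` by branching with the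
sure event, `E_{k+1}(1, U) = (k−1)·E_k(U)` [Sahi2008, Thm. 6]). [cite: Sahi2008, Thm. 6 (p. 214); LiebSahi2021, p. 3] -/
theorem masterFamilyNonneg_antitone : Antitone MasterFamilyNonneg := by
  refine antitone_nat_of_succ_le fun k h => ?_
  match k with
  | 0 => exact masterFamilyNonneg_of_le_two (by norm_num)
  | 1 => exact masterFamilyNonneg_of_le_two (by norm_num)
  | m + 2 =>
    intro ι _ p U hU
    have h1 := h ι p (Fin.cons Set.univ U) fun j => by
      refine Fin.cases ?_ (fun j => ?_) j
      · simpa using isUpperSet_univ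
      · simpa using hU j
    have hcons : (fun j => ind ((Fin.cons Set.univ U : Fin (m + 3) → Set (Set ι)) j)) =
        Matrix.vecCons 1 (fun j => ind (U j)) := by
      funext j
      refine Fin.cases ?_ (fun j => ?_) j
      · simp [ind_univ_eq_one]
      · simp
    rw [hcons, sahiE_one_cons (sum_bernoulliWeight p)] at h1
    have hk : (0 : ℝ) < (m + 1 : ℕ) := by positivity
    exact nonneg_of_mul_nonneg_right h1 hk

/-- `k = 3` of the master family IS Kahn's Conjecture 5 (three increasing events under a product measure).
[cite: Kahn2022, Conj. 5 (arXiv p. 3); LiebSahi2021, eq. (2.1)] -/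
theorem masterFamilyNonneg_three_iff_kahnConjecture : MasterFamilyNonneg 3 ↔ KahnConjecture := by
  constructor
  · intro h ι _ p A B C hA hB hC
    have h3 := h ι p ![A, B, C] fun j => by fin_cases j <;> assumption
    have e : (fun j => ind ((![A, B, C] : Fin 3 → Set (Set ι)) j)) = ![ind A, ind B, ind C] := by
      funext j; fin_cases j <;> rfl
    rwa [e, sahiE_three_ind] at h3
  · intro h ι _ p U hU
    have e : (fun j => ind (U j)) = ![ind (U 0), ind (U 1), ind (U 2)] := by
      funext j; fin_cases j <;> rfl
    rw [e, sahiE_three_ind]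
    exact h ι p (U 0) (U 1) (U 2) (hU 0) (hU 1) (hU 2)

/-- **`k = 3` on at most three coordinates is a theorem** (prim-sahi's kernel-checked certificate for `C₃` on
`{0,1}^m`, `m ≤ 3`: `SahiC3Cube.sahiC3_of_card_le_three`, standard axioms; `m = 4` is
`SahiC3Cube.sahiC3_of_card_le_four`, computational via `native_decide`, not used here). [this work] -/
theorem masterFamilyNonneg_three_of_card_le_three {ι : Type*} [Fintype ι] (hι : Fintype.card ι ≤ 3)
    (p : ι → unitInterval) (U : Fin 3 → Set (Set ι)) (hU : ∀ j, IsUpperSet (U j)) :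
    0 ≤ sahiE (bernoulliWeight p) 3 (fun j => ind (U j)) := by
  have e : (fun j => ind (U j)) = ![ind (U 0), ind (U 1), ind (U 2)] := by
    funext j; fin_cases j <;> rfl
  rw [e, sahiE_three_ind]
  exact SahiC3Cube.sahiC3_of_card_le_three hι p (hU 0) (hU 1) (hU 2)

/-! ### The master family on product measures: the conjectured equality locus -/

section ZeroFlag

variable {ι : Type*}

/-- **The support zero-flag class `Z_k`** of a family of events `U : Fin k → Set (Set ι)` — the conjectured
equality pattern `P(k)` of the master family, `p`-free and purely combinatorial:
* `k = 2`: `U_0`, `U_1` are determined by DISJOINT finite sets of coordinates (for increasing events under a product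
  measure in the open cube this is exactly `Cov(U_0, U_1) = 0`, the equality case of Harris' inequality);
* `k + 3`: for SOME slot `i`, the deleted family `U_{−i}` lies in `Z_{k+2}` and so does every family `U_{−i}` with
  one member `U_l` replaced by `U_l ∩ U_i`;
(orders `0`, `1`: `E_0 = 0` always, `E_1 = P(U_0) = 0` iff `U_0 = ∅`).  `k = 3` is the cell's criterion (Z):
after reordering `(X, Y, G)`, `X ⟂ Y`, `X ∩ G ⟂ Y`, `X ⟂ Y ∩ G` (`suppZeroFlag_three_of_Z`). [this work] -/
def SuppZeroFlag : (k : ℕ) → (Fin k → Set (Set ι)) → Prop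
  | 0, _ => True
  | 1, U => U 0 = ∅
  | 2, U => ∃ S T : Finset ι, Disjoint S T ∧ DeterminedBy (U 0) (↑S : Set ι) ∧ DeterminedBy (U 1) (↑T : Set ι)
  | k + 3, U => ∃ i : Fin (k + 3), SuppZeroFlag (k + 2) (fun j => U (i.succAbove j)) ∧
      ∀ l : Fin (k + 2), SuppZeroFlag (k + 2)
        (update (fun j => U (i.succAbove j)) l (U (i.succAbove l) ∩ U i))

/-- **(Z) is `Z_3`** (sufficient form, slot `2` peeled): if `X, Y` are determined by disjoint coordinate sets, and so
are `X ∩ G, Y` and `X, Y ∩ G`, then `(X, Y, G) ∈ Z_3`. [this work] -/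
theorem suppZeroFlag_three_of_Z {X Y G : Set (Set ι)} (hXY : SuppZeroFlag 2 ![X, Y])
    (hXG : SuppZeroFlag 2 ![X ∩ G, Y]) (hYG : SuppZeroFlag 2 ![X, Y ∩ G]) : SuppZeroFlag 3 ![X, Y, G] := by
  refine ⟨2, ?_, fun l => ?_⟩
  · have e : (fun j : Fin 2 => (![X, Y, G] : Fin 3 → Set (Set ι)) ((2 : Fin 3).succAbove j)) = ![X, Y] := by
      funext j; fin_cases j <;> rfl
    rw [e]; exact hXY
  · fin_cases l
    · have e : update (fun j : Fin 2 => (![X, Y, G] : Fin 3 → Set (Set ι)) ((2 : Fin 3).succAbove j)) 0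
          ((![X, Y, G] : Fin 3 → Set (Set ι)) ((2 : Fin 3).succAbove 0) ∩ (![X, Y, G] : Fin 3 → _) 2) =
          ![X ∩ G, Y] := by
        funext j; fin_cases j <;> rfl
      simp only [Fin.zero_eta]
      rw [e]; exact hXG
    · have e : update (fun j : Fin 2 => (![X, Y, G] : Fin 3 → Set (Set ι)) ((2 : Fin 3).succAbove j)) 1
          ((![X, Y, G] : Fin 3 → Set (Set ι)) ((2 : Fin 3).succAbove 1) ∩ (![X, Y, G] : Fin 3 → _) 2) =
          ![X, Y ∩ G] := by
        funext j; fin_cases j <;> rfl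
      simp only [Fin.mk_one]
      rw [e]; exact hYG

variable [Fintype ι]

omit [Fintype ι] in
/-- Indicators of an updated-by-intersection family are the updated-by-product indicator family (plumbing). [folklore] -/
theorem ind_update_inter {m : ℕ} (V : Fin m → Set (Set ι)) (l : Fin m) (W : Set (Set ι)) :
    (fun j => ind (update V l (V l ∩ W) j)) = update (fun j => ind (V j)) l (ind (V l) * ind W) := by
  funext j
  by_cases hj : j = l
  · subst hj
    simp only [update_self]
    funext ω
    exact Literature.Probability.Percolation.BHK2006.ind_inter _ _ ω
  · simp only [update_of_ne hj]

/-- The indicator of `∅` is `0`. [folklore] -/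
theorem ex_ind_empty (μ : Set ι → ℝ) : ex μ (ind (∅ : Set (Set ι))) = 0 := by
  simp only [ex]
  exact Finset.sum_eq_zero fun ω _ => by rw [ind_of_not_mem (Set.notMem_empty ω), mul_zero]

/-- **Support zero flags are zero flags of the product weight** (every `p ∈ [0,1]^ι`; no monotonicity): the base case
is Harris independence of disjointly determined events (`prodBernoulli_real_inter_of_determinedBy_disjoint`).
[this work] -/
theorem sahiZeroFlag_of_suppZeroFlag (p : ι → unitInterval) :
    ∀ (k : ℕ) (U : Fin k → Set (Set ι)), SuppZeroFlag k U →
      SahiZeroFlag (bernoulliWeight p) k (fun j => ind (U j))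
  | 0, _, _ => trivial
  | 1, U, h => by
    show ex (bernoulliWeight p) (ind (U 0)) = 0
    rw [h]; exact ex_ind_empty _
  | 2, U, ⟨S, T, hST, hS, hT⟩ => by
    show sahiE (bernoulliWeight p) 2 (fun j => ind (U j)) = 0
    rw [sahiE_two_apply]
    have hmul : ind (U 0) * ind (U 1) = ind (U 0 ∩ U 1) := by
      funext ω; exact (Literature.Probability.Percolation.BHK2006.ind_inter _ _ ω).symm
    rw [hmul, ex_bernoulliWeight_ind, ex_bernoulliWeight_ind, ex_bernoulliWeight_ind,
      prodBernoulli_real_inter_of_determinedBy_disjoint p hST hS hT MeasurableSet.of_discrete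
        MeasurableSet.of_discrete, sub_self]
  | k + 3, U, ⟨i, h0, hl⟩ => by
    refine ⟨i, sahiZeroFlag_of_suppZeroFlag p (k + 2) _ h0, fun l => ?_⟩
    have := sahiZeroFlag_of_suppZeroFlag p (k + 2) _ (hl l)
    rwa [ind_update_inter] at this

/-- **`Z_k ⇒ E_k = 0`** — the proved half of the master equality conjecture: for every `k`, every finite `ι`, every
`p : ι → [0,1]` and every family of events `U` in the zero-flag class, `E_k(μ_p; 1_{U_0},…,1_{U_{k−1}}) = 0`.
[this work] -/
theorem sahiE_ind_eq_zero_of_suppZeroFlag (p : ι → unitInterval) {k : ℕ} {U : Fin k → Set (Set ι)}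
    (hU : SuppZeroFlag k U) : sahiE (bernoulliWeight p) k (fun j => ind (U j)) = 0 :=
  sahiE_eq_zero_of_sahiZeroFlag _ k _ (sahiZeroFlag_of_suppZeroFlag p k U hU)

end ZeroFlag

/-- **Master family, equality half** (`masterFamily_eq_iff k` of the cell brief; OUR CONJECTURE for `k ≥ 3`): for
every finite `ι`, every `p` in the OPEN cube `(0,1)^ι` and every `k` increasing events,
`E_k(μ_p; 1_{U_0},…,1_{U_{k−1}}) = 0 ↔ U ∈ Z_k` (`SuppZeroFlag k U`).  `⇐` holds for every `k` and `p`
(`masterFamilyEqIff_mpr`); `⇒` is open for `k ≥ 3` (`k = 2`: equality case of Harris; `k = 3`: criterion (Z),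
verified exhaustively on `{0,1}^m`, `m ≤ 5`; `k = 4, 5`: verified exhaustively on `{0,1}^4`; `k ≤ 6` on `{0,1}^3`).
Given `MasterFamilyNonneg (k−1)` it is equivalent to heredity of zeros.  Never a fact. [this work]
[status: open for k ≥ 3] -/
@[conjecture] def MasterFamilyEqIff (k : ℕ) : Prop :=
  ∀ (ι : Type) [Fintype ι] (p : ι → unitInterval), (∀ e, (p e : ℝ) ∈ Set.Ioo (0 : ℝ) 1) →
    ∀ U : Fin k → Set (Set ι), (∀ j, IsUpperSet (U j)) →
      (sahiE (bernoulliWeight p) k (fun j => ind (U j)) = 0 ↔ SuppZeroFlag k U)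

/-- **The proved direction of `MasterFamilyEqIff k`, every `k`**: zero flags vanish (indeed for every `p ∈ [0,1]^ι`
and without monotonicity). [this work] -/
theorem masterFamilyEqIff_mpr (k : ℕ) (ι : Type) [Fintype ι] (p : ι → unitInterval) (U : Fin k → Set (Set ι))
    (hU : SuppZeroFlag k U) : sahiE (bernoulliWeight p) k (fun j => ind (U j)) = 0 :=
  sahiE_ind_eq_zero_of_suppZeroFlag p hU

/-- `MasterFamilyEqIff 0` (vacuous: `E_0 = 0` and `Z_0 =` everything). [this work] -/
theorem masterFamilyEqIff_zero : MasterFamilyEqIff 0 := fun ι _ p _ U _ =>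
  ⟨fun _ => trivial, fun h => masterFamilyEqIff_mpr 0 ι p U h⟩

/-- Every configuration has positive mass under a product measure in the OPEN cube. [folklore] -/
theorem bernoulliWeight_pos {ι : Type*} [Fintype ι] {p : ι → unitInterval}
    (hp : ∀ e, (p e : ℝ) ∈ Set.Ioo (0 : ℝ) 1) (ω : Set ι) : 0 < bernoulliWeight p ω := by
  classical
  show (0 : ℝ) < ∏ e, (if e ∈ ω then ((p e : ℝ)) else 1 - (p e : ℝ))
  exact Finset.prod_pos fun e _ => by
    split_ifs
    · exact (hp e).1
    · exact sub_pos.2 (hp e).2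

/-- `MasterFamilyEqIff 1`: in the open cube, `E_1(1_U) = P(U) = 0 ↔ U = ∅` (`Z_1`). [this work] -/
theorem masterFamilyEqIff_one : MasterFamilyEqIff 1 := by
  intro ι _ p hp U _
  refine ⟨fun h => ?_, fun h => masterFamilyEqIff_mpr 1 ι p U h⟩
  show U 0 = ∅
  rw [sahiE_one_apply, ex,
    Finset.sum_eq_zero_iff_of_nonneg fun ω _ => mul_nonneg (bernoulliWeight_pos hp ω).le (ind_nonneg _ _)] at h
  ext ω
  simp only [Set.mem_empty_iff_false, iff_false]
  intro hω
  have h1 := h ω (Finset.mem_univ ω)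
  rw [ind_of_mem hω, mul_one] at h1
  exact (bernoulliWeight_pos hp ω).ne' h1

/-- `MasterFamilyEqIff 2`, proved direction (`⇒` = strict Harris, "Cov = 0 ⇒ disjoint determining sets", is
classical but not yet in the tree, so `MasterFamilyEqIff 2` itself is not asserted here). [this work] -/
theorem masterFamilyEqIff_two_mpr (ι : Type) [Fintype ι] (p : ι → unitInterval) (U : Fin 2 → Set (Set ι))
    (hU : SuppZeroFlag 2 U) : sahiE (bernoulliWeight p) 2 (fun j => ind (U j)) = 0 :=
  masterFamilyEqIff_mpr 2 ι p U hU

end Summit.CriticalPhenomena.PercolationContinuityZ3.Theorems
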